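import Summits.CriticalPhenomena.PercolationContinuityZ3.Theorems.PercNearOneGluingNoHeavyLowerTailSunflowerRainbowReading
import HarnessLib
import HarnessLib.Audit

/-!
# `NoHeavyLowerTail` (crux stmt-CriticalPhenomena-4575), abstract sunflower cubic: READING LEMMAS for the two-stage rainbow vectors,
# part 2 — the exact values of the `M`-row / `N`-column functionals on `rbVec`

Support file (seat `prim-l12-p2` gen 19; `--supports stmt-CriticalPhenomena-4575`).  No `sorry`, no new definitions.
Memo: run/shared/lean/prim/prim-l12/prim-l12-p2/FINDING-g19-CUBE-DUAL-CERTIFICATE.md (§1).  Part 1: `…SunflowerRainbowReading`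
(`crossKeyGen`, `nu_read`, `mu_read`).

* `Sunflower.rbVec_read_bottom` — for a rainbow `ρ`, a bottom set `S` and a row `Z ⊆ Sᶜ` with `lab Z ∉ {1,4}`, the `M`-row functional
  `σ ↦ [σ.2 = S]·#{R' ∈ B : (σ.1∪σ.2)ᶜ ⊆ R' ⊆ Z}` evaluates on `rbVec ρ` to `[TS-B coefficient of ρ at S]·[lab (Sᶜ∖Z) = 4]·Φ_A(Q1, Sᶜ∖Z)`;
* `Sunflower.rbVec_read_kernel` — for a kernel set `X` and a column index `Y″ ⊆ Xᶜ` with `lab (Xᶜ∖Y″) ∈ {4,1,2}`, the `N`-column functional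
  `σ ↦ [σ.2 = X]·#{R ∈ A : Xᶜ∖Y″ ⊆ R ⊆ σ.1}` evaluates on `rbVec ρ` to `[TS-A coefficient of ρ at X]·Φ_B(Y″, Q3)`.
Both are EXACT (no parity junk).
* `Sunflower.certFun` (with `certN`, `certM`, `certProbe`) — the CUBE-DUAL CERTIFICATE functional `k_ρ ∈ GF(2)^{sup}` of a rainbow (memo §2):
  `k_ρ = Σ_{S,O} N_{Q1ᶜ}(S,Q3)·M_{Q1∪Q2}(Q2,O)·probe_{S,O}`, the probe being the `N`-column functional of column `S` at the kernel spectator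
  `X_O = (Q1∪Q2)∖O` when `lab((Q3∖S)∪O) ∈ {4,1,2}` and the `M`-row functional of row `(Q3∖S)∪O` at the bottom spectator `S` otherwise.
* `Sunflower.certFun_rbVec_diag` — **THEOREM: `⟨k_ρ, rbVec ρ⟩ = 1`** for every rainbow of every sunflower (each probe reads `m_ρ(S)·n_ρ(O)`
  exactly, so the pairing is the product of two diagonal instances of the cube theorem `crossKey`); `Sunflower.rbVec_ne_zero` — hence
  `rbVec ρ ≠ 0`.  The matrix `(⟨k_ρ', rbVec ρ⟩)` is the identity in > 99 % of sunflowers on ≤ 8 points (memo §4); making it unitriangular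
  in general would prove `RainbowKernelIndependence`, which remains OPEN.
-/

namespace Summit.CriticalPhenomena.PercolationContinuityZ3.Theorems.SunflowerPartition

open Finset

namespace Sunflower

variable {α : Type*} [Fintype α] [DecidableEq α] (F : Sunflower α)

/-! ## Reading `rbVec` with the `M`-row functional of a bottom cube / the `N`-column functional of a kernel cube -/

/-- **READING `rbVec` AT A BOTTOM CUBE** (this work).  For a rainbow `ρ = (Q1,Q2)` (`Q3 = (Q1∪Q2)ᶜ`), a bottom set `S` and a row index `Z ⊆ Sᶜ`
with `lab Z ∉ {1,4}`, the `M`-row functional of `Z` on the supplies with spectator `S`,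
`σ ↦ [σ.2 = S]·#{R' ∈ B : (σ.1 ∪ σ.2)ᶜ ⊆ R' ⊆ Z}`, evaluates on `rbVec ρ` to
`[TS-B coefficient of ρ at S] · [lab (Sᶜ∖Z) = 4] · #{R ∈ A : Q1 ⊆ R ⊆ Sᶜ ∖ Z}` (exact, no junk). [this work] -/
theorem rbVec_read_bottom {ρ : Finset α × Finset α} (hρ : ρ ∈ F.dem) (hr : F.IsRainbow ρ) {S Z : Finset α}
    (hS0 : F.lab S = 0) (hZ : Z ⊆ Sᶜ) (hZ1 : F.lab Z ≠ 1) (hZ4 : F.lab Z ≠ 4) :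
    (∑ σ ∈ F.sup, (if σ.2 = S then
        (∑ R' ∈ (Sᶜ).powerset, (if F.lab R' = 0 ∧ (σ.1 ∪ σ.2)ᶜ ⊆ R' ∧ R' ⊆ Z then (1 : ZMod 2) else 0)) * F.rbVec ρ σ else 0))
      = if F.lab S = 0 ∧ S ⊆ (ρ.1 ∪ ρ.2)ᶜ ∧ F.lab (Sᶜ \ ρ.1) = 4 then
          (∑ R' ∈ (Finset.univ : Finset α).powerset, (if F.lab R' = 0 ∧ S ⊆ R' ∧ R' ⊆ (ρ.1 ∪ ρ.2)ᶜ then (1 : ZMod 2) else 0)) *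
          (if F.lab (Sᶜ \ Z) = 4 then
              ∑ R ∈ (Sᶜ).powerset, (if F.lab R = 4 ∧ ρ.1 ⊆ R ∧ R ⊆ Sᶜ \ Z then (1 : ZMod 2) else 0) else 0)
        else 0 := by
  obtain ⟨-, hQ1, -, -⟩ := F.dem_rainbow_facts hρ hr
  rw [F.sum_sup_spectator S (Or.inr hS0)]
  by_cases hcond : F.lab S = 0 ∧ S ⊆ (ρ.1 ∪ ρ.2)ᶜ ∧ F.lab (Sᶜ \ ρ.1) = 4
  · have hPW : ρ.1 ⊆ Sᶜ := by
      intro x hx; rw [mem_compl]; intro hxS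
      have := hcond.2.1 hxS; rw [mem_compl, mem_union, not_or] at this; exact this.1 hx
    have key := F.nu_read Sᶜ (Y := Z) (P := ρ.1) hZ hPW hZ4 hZ1 hQ1 hcond.2.2
    rw [← Finset.sum_filter_add_sum_filter_not (Sᶜ).powerset (fun O => F.lab O = 0 ∧ F.lab (Sᶜ \ O) = 4)] at key
    rw [show (∑ O ∈ (Sᶜ).powerset.filter (fun O => ¬ (F.lab O = 0 ∧ F.lab (Sᶜ \ O) = 4)),
          (∑ R' ∈ (Sᶜ).powerset, (if F.lab R' = 0 ∧ O ⊆ R' ∧ R' ⊆ Z then (1 : ZMod 2) else 0)) *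
          (∑ R ∈ (Sᶜ).powerset, (if F.lab R = 4 ∧ ρ.1 ⊆ R ∧ R ⊆ Sᶜ \ O then (1 : ZMod 2) else 0))) = 0 from
        sum_eq_zero fun O hO => by
          have hO' := (mem_filter.1 hO).2
          by_cases h0 : F.lab O = 0
          · have h4 : F.lab (Sᶜ \ O) ≠ 4 := fun h => hO' ⟨h0, h⟩
            rw [show (∑ R ∈ (Sᶜ).powerset, (if F.lab R = 4 ∧ ρ.1 ⊆ R ∧ R ⊆ Sᶜ \ O then (1 : ZMod 2) else 0)) = 0 from
              sum_eq_zero fun R _ => if_neg fun h' => h4 (F.lab_eq_four_of_subset h'.2.2 h'.1), mul_zero]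
          · rw [F.crossM_eq_zero_of_lab_ne Sᶜ h0, zero_mul], add_zero] at key
    rw [if_pos hcond]
    rw [show (∑ O ∈ (Sᶜ).powerset.filter (fun O => F.lab O = 0 ∧ F.lab (Sᶜ \ O) = 4),
            (∑ R' ∈ (Sᶜ).powerset, (if F.lab R' = 0 ∧ ((Sᶜ \ O) ∪ S)ᶜ ⊆ R' ∧ R' ⊆ Z then (1 : ZMod 2) else 0)) * F.rbVec ρ (Sᶜ \ O, S))
        = (∑ R' ∈ (Finset.univ : Finset α).powerset, (if F.lab R' = 0 ∧ S ⊆ R' ∧ R' ⊆ (ρ.1 ∪ ρ.2)ᶜ then (1 : ZMod 2) else 0)) *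
          (∑ O ∈ (Sᶜ).powerset.filter (fun O => F.lab O = 0 ∧ F.lab (Sᶜ \ O) = 4),
            (∑ R' ∈ (Sᶜ).powerset, (if F.lab R' = 0 ∧ O ⊆ R' ∧ R' ⊆ Z then (1 : ZMod 2) else 0)) *
            (∑ R ∈ (Sᶜ).powerset, (if F.lab R = 4 ∧ ρ.1 ⊆ R ∧ R ⊆ Sᶜ \ O then (1 : ZMod 2) else 0))) from ?_]
    · rw [key]
    rw [Finset.mul_sum]
    refine sum_congr rfl fun O hO => ?_
    have hOW : O ⊆ Sᶜ := mem_powerset.1 (mem_filter.1 hO).1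
    have h3 : ((Sᶜ \ O) ∪ S)ᶜ = O := third_of_mk hOW
    unfold rbVec
    simp only
    rw [h3, if_pos hcond, if_neg (fun h => by rw [hS0] at h; exact absurd h.1 (by decide)), add_zero]
    ring
  · rw [if_neg hcond]
    refine sum_eq_zero fun O _ => ?_
    unfold rbVec
    simp only
    rw [if_neg hcond, if_neg (fun h => by rw [hS0] at h; exact absurd h.1 (by decide)), add_zero, mul_zero]

/-- **READING `rbVec` AT A KERNEL CUBE** (this work).  For a rainbow `ρ = (Q1,Q2)` (`Q3 = (Q1∪Q2)ᶜ`), a kernel spectator `X` and a column index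
`Y″ ⊆ Xᶜ` whose complement in the cube, `Xᶜ ∖ Y″`, has label `4`, `1` or `2`, the `N`-column functional of `Y″` on the supplies with spectator `X`,
`σ ↦ [σ.2 = X]·#{R ∈ A : Xᶜ∖Y″ ⊆ R ⊆ σ.1}`, evaluates on `rbVec ρ` to `[TS-A coefficient of ρ at X] · #{R' ∈ B : Y″ ⊆ R' ⊆ Q3}` (exact). [this work] -/
theorem rbVec_read_kernel {ρ : Finset α × Finset α} (hρ : ρ ∈ F.dem) (hr : F.IsRainbow ρ) {X Y'' : Finset α}
    (hX4 : F.lab X = 4) (hY'' : Y'' ⊆ Xᶜ) (hZ : F.lab (Xᶜ \ Y'') = 4 ∨ F.lab (Xᶜ \ Y'') = 1 ∨ F.lab (Xᶜ \ Y'') = 2) :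
    (∑ σ ∈ F.sup, (if σ.2 = X then
        (∑ R ∈ (Xᶜ).powerset, (if F.lab R = 4 ∧ Xᶜ \ Y'' ⊆ R ∧ R ⊆ Xᶜ \ (σ.1 ∪ σ.2)ᶜ then (1 : ZMod 2) else 0)) * F.rbVec ρ σ else 0))
      = if F.lab X = 4 ∧ ρ.1 ⊆ X ∧ (ρ.1 ∪ ρ.2)ᶜ ⊆ Xᶜ ∧ F.lab (Xᶜ \ (ρ.1 ∪ ρ.2)ᶜ) = 0 then
          (∑ R ∈ (Finset.univ : Finset α).powerset, (if F.lab R = 4 ∧ ρ.1 ⊆ R ∧ R ⊆ X then (1 : ZMod 2) else 0)) *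
          (∑ R' ∈ (Xᶜ).powerset, (if F.lab R' = 0 ∧ Y'' ⊆ R' ∧ R' ⊆ (ρ.1 ∪ ρ.2)ᶜ then (1 : ZMod 2) else 0))
        else 0 := by
  obtain ⟨-, -, -, hQ3⟩ := F.dem_rainbow_facts hρ hr
  have hX0 : F.lab X ≠ 0 := by rw [hX4]; decide
  rw [F.sum_sup_spectator X (Or.inl hX4)]
  by_cases hcond : F.lab X = 4 ∧ ρ.1 ⊆ X ∧ (ρ.1 ∪ ρ.2)ᶜ ⊆ Xᶜ ∧ F.lab (Xᶜ \ (ρ.1 ∪ ρ.2)ᶜ) = 0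
  · have key := F.mu_read Xᶜ (Q := (ρ.1 ∪ ρ.2)ᶜ) (S := Y'') hcond.2.2.1 hY'' hQ3 hcond.2.2.2 hZ
    rw [← Finset.sum_filter_add_sum_filter_not (Xᶜ).powerset (fun O => F.lab O = 0 ∧ F.lab (Xᶜ \ O) = 4)] at key
    rw [show (∑ O ∈ (Xᶜ).powerset.filter (fun O => ¬ (F.lab O = 0 ∧ F.lab (Xᶜ \ O) = 4)),
          (∑ R' ∈ (Xᶜ).powerset, (if F.lab R' = 0 ∧ O ⊆ R' ∧ R' ⊆ (ρ.1 ∪ ρ.2)ᶜ then (1 : ZMod 2) else 0)) *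
          (∑ R ∈ (Xᶜ).powerset, (if F.lab R = 4 ∧ Xᶜ \ Y'' ⊆ R ∧ R ⊆ Xᶜ \ O then (1 : ZMod 2) else 0))) = 0 from
        sum_eq_zero fun O hO => by
          have hO' := (mem_filter.1 hO).2
          by_cases h0 : F.lab O = 0
          · have h4 : F.lab (Xᶜ \ O) ≠ 4 := fun h => hO' ⟨h0, h⟩
            rw [F.crossN_eq_zero_of_lab_ne Xᶜ h4, mul_zero]
          · rw [F.crossM_eq_zero_of_lab_ne Xᶜ h0, zero_mul], add_zero] at key
    rw [if_pos hcond]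
    rw [show (∑ O ∈ (Xᶜ).powerset.filter (fun O => F.lab O = 0 ∧ F.lab (Xᶜ \ O) = 4),
            (∑ R ∈ (Xᶜ).powerset, (if F.lab R = 4 ∧ Xᶜ \ Y'' ⊆ R ∧ R ⊆ Xᶜ \ ((Xᶜ \ O) ∪ X)ᶜ then (1 : ZMod 2) else 0)) *
              F.rbVec ρ (Xᶜ \ O, X))
        = (∑ R ∈ (Finset.univ : Finset α).powerset, (if F.lab R = 4 ∧ ρ.1 ⊆ R ∧ R ⊆ X then (1 : ZMod 2) else 0)) *
          (∑ O ∈ (Xᶜ).powerset.filter (fun O => F.lab O = 0 ∧ F.lab (Xᶜ \ O) = 4),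
            (∑ R' ∈ (Xᶜ).powerset, (if F.lab R' = 0 ∧ O ⊆ R' ∧ R' ⊆ (ρ.1 ∪ ρ.2)ᶜ then (1 : ZMod 2) else 0)) *
            (∑ R ∈ (Xᶜ).powerset, (if F.lab R = 4 ∧ Xᶜ \ Y'' ⊆ R ∧ R ⊆ Xᶜ \ O then (1 : ZMod 2) else 0))) from ?_]
    · rw [key]
    rw [Finset.mul_sum]
    refine sum_congr rfl fun O hO => ?_
    have hOW : O ⊆ Xᶜ := mem_powerset.1 (mem_filter.1 hO).1
    have h3 : ((Xᶜ \ O) ∪ X)ᶜ = O := third_of_mk hOW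
    unfold rbVec
    simp only
    rw [h3, if_neg (fun h => hX0 h.1), if_pos hcond, zero_add]
    ring
  · rw [if_neg hcond]
    refine sum_eq_zero fun O _ => ?_
    unfold rbVec
    simp only
    rw [if_neg (fun h => hX0 h.1), if_neg hcond, zero_add, mul_zero]


/-! ## The cube-dual certificate functional and its exact diagonal -/

omit [Fintype α] in
/-- Restricting an interval-indicator sum to the powerset of the interval's top. [folklore] -/
theorem sum_pow_to (v : Fin 5) (L X T : Finset α) (hXT : X ⊆ T) :
    (∑ R ∈ T.powerset, (if F.lab R = v ∧ L ⊆ R ∧ R ⊆ X then (1 : ZMod 2) else 0))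
      = ∑ R ∈ X.powerset, (if F.lab R = v ∧ L ⊆ R ∧ R ⊆ X then (1 : ZMod 2) else 0) := by
  symm
  refine Finset.sum_subset (powerset_mono.2 hXT) fun R _ hR => ?_
  rw [mem_powerset] at hR
  exact if_neg fun h => hR h.2.2

/-- The `N`-weight of the certificate: `n'(S) = N_{Q1ᶜ}(S, Q3) = #{R ∈ A : Q1ᶜ ∖ Q3 ⊆ R ⊆ Q1ᶜ ∖ S}`. [this work] -/
def certN (ρ : Finset α × Finset α) (S : Finset α) : ZMod 2 :=
  ∑ R ∈ (ρ.1ᶜ).powerset, (if F.lab R = 4 ∧ ρ.1ᶜ \ (ρ.1 ∪ ρ.2)ᶜ ⊆ R ∧ R ⊆ ρ.1ᶜ \ S then (1 : ZMod 2) else 0)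

/-- The `M`-weight of the certificate: `m'(O) = M_{Q1∪Q2}(Q2, O) = #{R' ∈ B : O ⊆ R' ⊆ Q2}`. [this work] -/
def certM (ρ : Finset α × Finset α) (O : Finset α) : ZMod 2 :=
  ∑ R' ∈ (ρ.1 ∪ ρ.2).powerset, (if F.lab R' = 0 ∧ O ⊆ R' ∧ R' ⊆ ρ.2 then (1 : ZMod 2) else 0)

/-- The probe functional of the pair `(S,O)`: with `Z = (Q3 ∖ S) ∪ O` and `X = (Q1 ∪ Q2) ∖ O`, the `N`-column functional of column `S` at the
kernel spectator `X` if `lab Z ∈ {4,1,2}`, else the `M`-row functional of row `Z` at the bottom spectator `S`. [this work] -/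
def certProbe (ρ : Finset α × Finset α) (S O : Finset α) (σ : Finset α × Finset α) : ZMod 2 :=
  if F.lab (((ρ.1 ∪ ρ.2)ᶜ \ S) ∪ O) = 4 ∨ F.lab (((ρ.1 ∪ ρ.2)ᶜ \ S) ∪ O) = 1 ∨ F.lab (((ρ.1 ∪ ρ.2)ᶜ \ S) ∪ O) = 2 then
    (if σ.2 = (ρ.1 ∪ ρ.2) \ O then
      ∑ R ∈ (((ρ.1 ∪ ρ.2) \ O)ᶜ).powerset,
        (if F.lab R = 4 ∧ ((ρ.1 ∪ ρ.2) \ O)ᶜ \ S ⊆ R ∧ R ⊆ ((ρ.1 ∪ ρ.2) \ O)ᶜ \ (σ.1 ∪ σ.2)ᶜ then (1 : ZMod 2) else 0)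
     else 0)
  else
    (if σ.2 = S then
      ∑ R' ∈ (Sᶜ).powerset, (if F.lab R' = 0 ∧ (σ.1 ∪ σ.2)ᶜ ⊆ R' ∧ R' ⊆ ((ρ.1 ∪ ρ.2)ᶜ \ S) ∪ O then (1 : ZMod 2) else 0)
     else 0)

/-- **The cube-dual certificate functional** `k_ρ ∈ GF(2)^{sup}` of a rainbow `ρ` (memo §2):
`k_ρ = Σ_{S ∈ AB(Q1ᶜ), S ⊆ Q3} Σ_{O ∈ AB(Q1∪Q2), O ⊆ Q2} n'(S)·m'(O)·probe_{S,O}`. [this work] -/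
def certFun (ρ σ : Finset α × Finset α) : ZMod 2 :=
  ∑ S ∈ ((ρ.1 ∪ ρ.2)ᶜ).powerset.filter (fun S => F.lab S = 0 ∧ F.lab (ρ.1ᶜ \ S) = 4),
    ∑ O ∈ (ρ.2).powerset.filter (fun O => F.lab O = 0 ∧ F.lab ((ρ.1 ∪ ρ.2) \ O) = 4),
      F.certN ρ S * F.certM ρ O * F.certProbe ρ S O σ

/-- **EXACT DIAGONAL OF THE CUBE-DUAL CERTIFICATE** (this work): `⟨k_ρ, rbVec ρ⟩ = 1` for every rainbow `ρ` of every sunflower.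
Each probe reads `rbVec ρ` exactly as `m_ρ(S)·n_ρ(O)` (`rbVec_read_bottom` / `rbVec_read_kernel`), so the pairing factors as
`[Σ_S N(S,Q3)M(Q3,S)]·[Σ_O M(Q2,O)N(O,Q2)]` — two diagonal instances of the cube theorem `crossKey`.  COROLLARY: `rbVec ρ ≠ 0`. [this work] -/
theorem certFun_rbVec_diag {ρ : Finset α × Finset α} (hρ : ρ ∈ F.dem) (hr : F.IsRainbow ρ) :
    (∑ σ ∈ F.sup, F.certFun ρ σ * F.rbVec ρ σ) = 1 := by
  obtain ⟨hdisj, hQ1, hQ2, hQ3⟩ := F.dem_rainbow_facts hρ hr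
  -- names
  set Q3 := (ρ.1 ∪ ρ.2)ᶜ with hQ3def
  set filtS := (Q3).powerset.filter (fun S => F.lab S = 0 ∧ F.lab (ρ.1ᶜ \ S) = 4) with hfS
  set filtO := (ρ.2).powerset.filter (fun O => F.lab O = 0 ∧ F.lab ((ρ.1 ∪ ρ.2) \ O) = 4) with hfO
  -- the two `M`/`N` entries of `ρ` itself
  let mS : Finset α → ZMod 2 := fun S =>
    ∑ R' ∈ (ρ.1ᶜ).powerset, (if F.lab R' = 0 ∧ S ⊆ R' ∧ R' ⊆ Q3 then (1 : ZMod 2) else 0)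
  let nO : Finset α → ZMod 2 := fun O =>
    ∑ R ∈ (ρ.1 ∪ ρ.2).powerset, (if F.lab R = 4 ∧ (ρ.1 ∪ ρ.2) \ ρ.2 ⊆ R ∧ R ⊆ (ρ.1 ∪ ρ.2) \ O then (1 : ZMod 2) else 0)
  have hUQ2 : (ρ.1 ∪ ρ.2) \ ρ.2 = ρ.1 := by
    ext x; simp only [mem_sdiff, mem_union]
    constructor
    · rintro ⟨h | h, h2⟩
      · exact h
      · exact absurd h h2
    · intro h; exact ⟨Or.inl h, fun h2 => (Finset.disjoint_left.1 hdisj) h h2⟩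
  -- STEP 1: exchange the sums
  have step1 : (∑ σ ∈ F.sup, F.certFun ρ σ * F.rbVec ρ σ)
      = ∑ S ∈ filtS, ∑ O ∈ filtO, F.certN ρ S * F.certM ρ O * (∑ σ ∈ F.sup, F.certProbe ρ S O σ * F.rbVec ρ σ) := by
    unfold certFun
    rw [show (∑ σ ∈ F.sup, (∑ S ∈ filtS, ∑ O ∈ filtO, F.certN ρ S * F.certM ρ O * F.certProbe ρ S O σ) * F.rbVec ρ σ)
        = ∑ σ ∈ F.sup, ∑ S ∈ filtS, ∑ O ∈ filtO, F.certN ρ S * F.certM ρ O * (F.certProbe ρ S O σ * F.rbVec ρ σ) from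
      sum_congr rfl fun σ _ => by
        rw [Finset.sum_mul]; refine sum_congr rfl fun S _ => ?_
        rw [Finset.sum_mul]; refine sum_congr rfl fun O _ => ?_
        ring]
    rw [Finset.sum_comm]
    refine sum_congr rfl fun S _ => ?_
    rw [Finset.sum_comm]
    refine sum_congr rfl fun O _ => ?_
    rw [Finset.mul_sum]
  rw [step1]
  -- STEP 2: each probe reads `m_ρ(S) · n_ρ(O)` exactly
  have step2 : ∀ S ∈ filtS, ∀ O ∈ filtO,
      (∑ σ ∈ F.sup, F.certProbe ρ S O σ * F.rbVec ρ σ) = mS S * nO O := by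
    intro S hS O hO
    obtain ⟨hSQ3, hS0, hS4⟩ := mem_filter.1 hS
    obtain ⟨hOQ2, hO0, hO4⟩ := mem_filter.1 hO
    rw [mem_powerset] at hSQ3 hOQ2
    set X := (ρ.1 ∪ ρ.2) \ O with hXdef
    set Z := (Q3 \ S) ∪ O with hZdef
    -- set identities
    have hSO : Disjoint S O := by
      refine Finset.disjoint_left.2 fun x hxS hxO => ?_
      have := hSQ3 hxS; rw [hQ3def, mem_compl, mem_union, not_or] at this; exact this.2 (hOQ2 hxO)
    have hXc : Xᶜ = Q3 ∪ O := by
      ext x; simp only [hXdef, hQ3def, mem_compl, mem_sdiff, mem_union, not_and, not_not]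
      constructor
      · intro h; by_cases hx : x ∈ ρ.1 ∨ x ∈ ρ.2
        · exact Or.inr (h hx)
        · exact Or.inl hx
      · rintro (h | h)
        · exact fun hx => absurd hx h
        · exact fun _ => h
    have hXcS : Xᶜ \ S = Z := by
      rw [hXc, hZdef]; ext x; simp only [mem_sdiff, mem_union]
      constructor
      · rintro ⟨h | h, hnS⟩
        · exact Or.inl ⟨h, hnS⟩
        · exact Or.inr h
      · rintro (⟨h, hnS⟩ | h)
        · exact ⟨Or.inl h, hnS⟩
        · exact ⟨Or.inr h, fun hxS => (Finset.disjoint_left.1 hSO) hxS h⟩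
    have hZSc : Z ⊆ Sᶜ := by
      intro x hx; rw [mem_compl]; intro hxS; rw [hZdef, mem_union] at hx
      rcases hx with h | h
      · exact (mem_sdiff.1 h).2 hxS
      · exact (Finset.disjoint_left.1 hSO) hxS h
    have h1X : ρ.1 ⊆ X := by
      intro x hx; rw [hXdef, mem_sdiff]
      exact ⟨mem_union_left _ hx, fun hxO => (Finset.disjoint_left.1 hdisj) hx (hOQ2 hxO)⟩
    have hXU : X ⊆ ρ.1 ∪ ρ.2 := sdiff_subset
    have hQ3Xc : Q3 ⊆ Xᶜ := by rw [hXc]; exact subset_union_left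
    have hQ3U1 : Q3 ⊆ ρ.1ᶜ := by
      intro x hx; rw [hQ3def, mem_compl, mem_union, not_or] at hx; exact mem_compl.2 hx.1
    have hXcQ3 : Xᶜ \ Q3 = O := by
      rw [hXc]; ext x; simp only [mem_sdiff, mem_union]
      constructor
      · rintro ⟨h | h, hn⟩
        · exact absurd h hn
        · exact h
      · intro h; refine ⟨Or.inr h, fun hQ => ?_⟩
        rw [hQ3def, mem_compl, mem_union, not_or] at hQ; exact hQ.2 (hOQ2 h)
    have hScZ : Sᶜ \ Z = X := by
      ext x
      constructor
      · intro hx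
        obtain ⟨hxS, hxZ⟩ := mem_sdiff.1 hx
        rw [mem_compl] at hxS
        rw [hZdef, mem_union, not_or, mem_sdiff] at hxZ
        have hxQ3 : x ∉ Q3 := fun h => hxZ.1 ⟨h, hxS⟩
        rw [hQ3def, mem_compl, not_not] at hxQ3
        rw [hXdef, mem_sdiff]; exact ⟨hxQ3, hxZ.2⟩
      · intro hx
        obtain ⟨hU, hxO⟩ := mem_sdiff.1 (show x ∈ (ρ.1 ∪ ρ.2) \ O by rw [hXdef] at hx; exact hx)
        have hxQ3 : x ∉ Q3 := by rw [hQ3def, mem_compl, not_not]; exact hU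
        refine mem_sdiff.2 ⟨mem_compl.2 fun hxS => hxQ3 (hSQ3 hxS), ?_⟩
        rw [hZdef, mem_union, not_or, mem_sdiff]
        exact ⟨fun h => hxQ3 h.1, hxO⟩
    have hScQ1 : Sᶜ \ ρ.1 = ρ.1ᶜ \ S := by
      ext x; simp only [mem_sdiff, mem_compl]; tauto
    have hXSc : X ⊆ Sᶜ := by rw [← hScZ]; exact sdiff_subset
    -- the target value, in canonical indexings
    have hmS : mS S = ∑ R' ∈ Q3.powerset, (if F.lab R' = 0 ∧ S ⊆ R' ∧ R' ⊆ Q3 then (1 : ZMod 2) else 0) :=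
      F.sum_pow_to 0 S Q3 ρ.1ᶜ hQ3U1
    have hnO : nO O = ∑ R ∈ X.powerset, (if F.lab R = 4 ∧ ρ.1 ⊆ R ∧ R ⊆ X then (1 : ZMod 2) else 0) := by
      show (∑ R ∈ (ρ.1 ∪ ρ.2).powerset,
          (if F.lab R = 4 ∧ (ρ.1 ∪ ρ.2) \ ρ.2 ⊆ R ∧ R ⊆ (ρ.1 ∪ ρ.2) \ O then (1 : ZMod 2) else 0)) = _
      rw [hUQ2]
      exact F.sum_pow_to 4 ρ.1 X (ρ.1 ∪ ρ.2) hXU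
    unfold certProbe
    rw [show ((ρ.1 ∪ ρ.2)ᶜ \ S) ∪ O = Z from by rw [hZdef], show (ρ.1 ∪ ρ.2) \ O = X from by rw [hXdef]]
    by_cases htype : F.lab Z = 4 ∨ F.lab Z = 1 ∨ F.lab Z = 2
    · -- type A: the `N`-column functional of column `S` at kernel spectator `X`
      simp only [htype, ite_true, ite_mul, zero_mul]
      rw [F.rbVec_read_kernel hρ hr (X := X) (Y'' := S) hO4 (hSQ3.trans hQ3Xc) (by rw [hXcS]; exact htype)]
      rw [if_pos ⟨hO4, h1X, hQ3Xc, by rw [hXcQ3]; exact hO0⟩]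
      rw [hmS, hnO, F.sum_pow_to 4 ρ.1 X Finset.univ (subset_univ _), F.sum_pow_to 0 S Q3 Xᶜ hQ3Xc, mul_comm]
    · -- type B: the `M`-row functional of row `Z` at bottom spectator `S`
      have hZ4 : F.lab Z ≠ 4 := fun h => htype (Or.inl h)
      have hZ1 : F.lab Z ≠ 1 := fun h => htype (Or.inr (Or.inl h))
      simp only [htype, ite_false, ite_mul, zero_mul]
      rw [F.rbVec_read_bottom hρ hr hS0 hZSc hZ1 hZ4]
      rw [if_pos ⟨hS0, hSQ3, by rw [hScQ1]; exact hS4⟩, hScZ, if_pos hO4]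
      rw [hmS, hnO, F.sum_pow_to 0 S Q3 Finset.univ (subset_univ _), F.sum_pow_to 4 ρ.1 X Sᶜ hXSc]
  rw [sum_congr rfl fun S hS => sum_congr rfl fun O hO => by rw [step2 S hS O hO]]
  -- STEP 3: factor
  rw [show (∑ S ∈ filtS, ∑ O ∈ filtO, F.certN ρ S * F.certM ρ O * (mS S * nO O))
      = ∑ S ∈ filtS, ∑ O ∈ filtO, (mS S * F.certN ρ S) * (F.certM ρ O * nO O) from
    sum_congr rfl fun S _ => sum_congr rfl fun O _ => by ring]
  rw [← Finset.sum_mul_sum]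
  -- STEP 4: `Σ_S M(Q3,S)N(S,Q3) = 1` in the cube `Q1ᶜ` (cube theorem, diagonal entry of the (2|3)-row `Q3`)
  have hU1Q3 : ρ.1ᶜ \ Q3 = ρ.2 := by
    ext x; simp only [hQ3def, mem_sdiff, mem_compl, mem_union, not_or, not_and, not_not]
    constructor
    · rintro ⟨h1, h⟩; exact h h1
    · intro h2; exact ⟨fun h1 => (Finset.disjoint_left.1 hdisj) h1 h2, fun _ => h2⟩
  have hQ3U1 : Q3 ⊆ ρ.1ᶜ := by
    intro x hx; rw [hQ3def, mem_compl, mem_union, not_or] at hx; exact mem_compl.2 hx.1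
  have step4 : (∑ S ∈ filtS, mS S * F.certN ρ S) = 1 := by
    have key := F.crossKey ρ.1ᶜ (Y := Q3) (Y'' := Q3) hQ3U1 hQ3U1 (by rw [hQ3]; decide)
      (by rw [hU1Q3, hQ2]; decide) (by rw [hQ3]; decide) (by rw [hU1Q3, hQ2]; decide) (by rw [hU1Q3, hQ2]; decide)
      (by rw [hU1Q3, hQ2, hQ3]; decide)
    rw [if_pos rfl] at key
    rw [← key]
    refine Finset.sum_subset (fun S hS => mem_powerset.2 ((mem_powerset.1 (mem_filter.1 hS).1).trans hQ3U1)) fun S hSW hSf => ?_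
    -- outside the filter the summand vanishes
    have hSW' : S ⊆ ρ.1ᶜ := mem_powerset.1 hSW
    by_cases hSQ3 : S ⊆ Q3
    · by_cases hS0 : F.lab S = 0
      · have hS4 : F.lab (ρ.1ᶜ \ S) ≠ 4 := fun h => hSf (mem_filter.2 ⟨mem_powerset.2 hSQ3, hS0, h⟩)
        show mS S * F.certN ρ S = 0
        unfold certN
        rw [show ρ.1ᶜ \ (ρ.1 ∪ ρ.2)ᶜ = ρ.1ᶜ \ Q3 from rfl, F.crossN_eq_zero_of_lab_ne ρ.1ᶜ (Y'' := Q3) hS4, mul_zero]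
      · show mS S * F.certN ρ S = 0
        rw [show mS S = 0 from F.crossM_eq_zero_of_lab_ne ρ.1ᶜ (Y := Q3) hS0, zero_mul]
    · show mS S * F.certN ρ S = 0
      rw [show mS S = 0 from sum_eq_zero fun R' _ => if_neg fun h => hSQ3 (h.2.1.trans h.2.2), zero_mul]
  -- STEP 5: `Σ_O M(Q2,O)N(O,Q2) = 1` in the cube `Q1 ∪ Q2` (cube theorem, diagonal entry of the (1|2)-column `Q2`)
  have step5 : (∑ O ∈ filtO, F.certM ρ O * nO O) = 1 := by
    have key := F.crossKey (ρ.1 ∪ ρ.2) (Y := ρ.2) (Y'' := ρ.2) subset_union_right subset_union_right (by rw [hQ2]; decide)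
      (by rw [hUQ2, hQ1]; decide) (by rw [hQ2]; decide) (by rw [hUQ2, hQ1]; decide) (by rw [hUQ2, hQ1]; decide)
      (by rw [hUQ2, hQ1, hQ2]; decide)
    rw [if_pos rfl] at key
    rw [← key]
    refine Finset.sum_subset (fun O hO => mem_powerset.2 ((mem_powerset.1 (mem_filter.1 hO).1).trans subset_union_right))
      fun O hOW hOf => ?_
    by_cases hOQ2 : O ⊆ ρ.2
    · by_cases hO0 : F.lab O = 0
      · have hO4 : F.lab ((ρ.1 ∪ ρ.2) \ O) ≠ 4 := fun h => hOf (mem_filter.2 ⟨mem_powerset.2 hOQ2, hO0, h⟩)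
        show F.certM ρ O * nO O = 0
        rw [show nO O = 0 from F.crossN_eq_zero_of_lab_ne (ρ.1 ∪ ρ.2) (Y'' := ρ.2) hO4, mul_zero]
      · show F.certM ρ O * nO O = 0
        unfold certM
        rw [F.crossM_eq_zero_of_lab_ne (ρ.1 ∪ ρ.2) (Y := ρ.2) hO0, zero_mul]
    · show F.certM ρ O * nO O = 0
      unfold certM
      rw [show (∑ R' ∈ (ρ.1 ∪ ρ.2).powerset, (if F.lab R' = 0 ∧ O ⊆ R' ∧ R' ⊆ ρ.2 then (1 : ZMod 2) else 0)) = 0 from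
        sum_eq_zero fun R' _ => if_neg fun h => hOQ2 (h.2.1.trans h.2.2), zero_mul]
  rw [step4, step5, mul_one]

/-- **COROLLARY**: every two-stage rainbow vector is NONZERO on the supplies (there is a supply `σ` with `rbVec ρ σ ≠ 0`). [this work] -/
theorem rbVec_ne_zero {ρ : Finset α × Finset α} (hρ : ρ ∈ F.dem) (hr : F.IsRainbow ρ) : ∃ σ ∈ F.sup, F.rbVec ρ σ ≠ 0 := by
  by_contra h
  have h' : ∀ σ ∈ F.sup, F.rbVec ρ σ = 0 := fun σ hσ => by
    by_contra hne
    exact h ⟨σ, hσ, hne⟩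
  have := F.certFun_rbVec_diag hρ hr
  rw [sum_eq_zero fun σ hσ => by rw [h' σ hσ, mul_zero]] at this
  exact zero_ne_one this

end Sunflower

end Summit.CriticalPhenomena.PercolationContinuityZ3.Theorems.SunflowerPartition
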